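import Mathlib
import HarnessLib
import Summits.QuantumAdvantage.QuantumAdvantage.Theses.SpikesNeedAddresses
import Summits.QuantumAdvantage.QuantumAdvantage.Theses.RandomOracleGauge
import Literature.Barriers.QuantumAdvantage.RandomOracleMethodThm23
import Literature.Computability.QuantumComplexity.RandomOracleIndependence
import Literature.Computability.Cryptography.QuantumCircuitProofs

/-!
# SplitGlue — typed decomposition of the crux `PromiseTransfer` (stmt-QuantumAdvantage-10749 = RandomOracleGauge spelling / -11702 = SpikesNeedAddresses spelling): the two pieces and the PROVED glue (strategist, 2026-08-17)

Two pieces over the route file's own vocabulary (ClassBQP / Promise / Oracle / Mathlib only):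

* `PromiseOracleSimulation`  — Aaronson–Ambainis Thm 23 RELATIVE TO A PROMISE ORACLE: granted the
  Aaronson–Ambainis conjecture, every uniform quantum oracle family `F` is decided on input `x`, for all
  but a `1/(r(n)+1)` measure of random oracles `A`, by ONE deterministic polynomial-time transcript
  machine `C` querying the combined oracle `A ⊕ g`, for EVERY answer function `g` consistent with a fixed
  promise problem `Q ∈ PromiseBQP` (adversarial off the promise) — the robust greedy + hashing, no coins;
* `PromiseOracleElimination` — a `PromiseBPP'` oracle is redundant relative to a random oracle: the
  `g`-queries of any such `C` can be answered from FAR oracle positions (a finite window `V` of strings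
  longer than `ℓ(n)`), by a deterministic poly-time `C'` with oracle `A` alone, so that every output of
  `C^{A ⊕ ĝ(A)}` is reproduced by `C'^A` and `ĝ(A)` is inconsistent with `Q` only on measure `≤ 1/(r(n)+1)`.

Glue `promiseTransfer_of_subs` (PROVED below, no sorry): `PromiseBQP ⊆ PromiseBPP'` moves `Q` into
`PromiseBPP'`; the bad event of `C'` is covered by the inconsistency event plus the event
"`ĝ(A)` consistent and `C^{A ⊕ ĝ(A)}` wrong"; the latter is bounded by the Bennett–Gill window lemma
(`measure_inter_le_of_window`): patching the SHORT window (strings of length `≤ ℓ(n)`, which determine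
`F^A(x)` and the `A`-queries of `C`) leaves `ĝ` unchanged (it reads only `V`, all longer), so each
background contributes at most the piece-1 bound for the FIXED consistent `g = ĝ(A₀)`; union bound,
`1/(2n³+1) + 1/(4n³+1) < 1/n³`, and the tree's Markov/Borel–Cantelli half
`ae_BQPRel_subset_AvgPRel_of_apxMachines`.
-/

set_option linter.dupNamespace false

noncomputable section

namespace Summit.QuantumAdvantage.QuantumAdvantage.Cruxes.PromiseTransfer.PromiseOracleSplit

open MeasureTheory Literature.Computability.Complexity Literature.Computability.Cryptography
  Literature.Computability.QuantumComplexity Literature.Barriers.QuantumAdvantage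
open scoped ENNReal

/-- Piece 1 (crux): Aaronson–Ambainis' average-case simulation with a PROMISE-BQP oracle in place of `#P`. -/
def PromiseOracleSimulation : Prop :=
  (∃ (c : ℕ) (C : ℝ), 0 < C ∧ ∀ (N d : ℕ) (p : MvPolynomial (Fin N) ℝ) (ε : ℝ), let ev : (Fin N → Bool) → ℝ := fun x => MvPolynomial.eval (fun i => if x i then (1 : ℝ) else 0) p; let avg : ((Fin N → Bool) → ℝ) → ℝ := fun f => (∑ x : Fin N → Bool, f x) / (2 : ℝ) ^ N; 1 ≤ d → p.totalDegree ≤ d → (∀ x, 0 ≤ ev x ∧ ev x ≤ 1) → 0 < ε → ε ≤ (avg fun x => (ev x - avg ev) ^ 2) → ∃ i : Fin N, C * (ε / d) ^ c ≤ (avg fun x => (ev x - ev (Function.update x i (!x i))) ^ 2)) →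
  ∀ F : QCircuitFamily cliffordT, F.IsUniform → ∀ r : Polynomial ℕ,
    ∃ Q ∈ Literature.Computability.Cryptography.PromiseBQP, ∃ (C : OracleAlg Bool) (q : Polynomial ℕ),
      C.IsPolyTime Computability.encodingBoolBool ∧
      (∀ (O : Oracle) (x : List Bool), ∀ y ∈ C.queries O (q.eval x.length) x, y.length ≤ q.eval x.length) ∧
      ∀ x : List Bool, 1 ≤ x.length → ∀ g : List Bool → Bool,
        (∀ v ∈ Q.yes, g v = true) → (∀ v ∈ Q.no, g v = false) →
        (ProbabilityTheory.setBernoulli (Set.univ : Set (List Bool)) ⟨1 / 2, by norm_num, by norm_num⟩)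
          {A : Set (List Bool) |
            (2 / 3 ≤ F.acceptProbOn A x ∧
              C.run (Oracle.ofLanguage {w : List Bool | ∃ v : List Bool, (w = false :: v ∧ v ∈ A) ∨ (w = true :: v ∧ g v = true)}) (q.eval x.length) x ≠ some true) ∨
            (F.acceptProbOn A x ≤ 1 / 3 ∧
              C.run (Oracle.ofLanguage {w : List Bool | ∃ v : List Bool, (w = false :: v ∧ v ∈ A) ∨ (w = true :: v ∧ g v = true)}) (q.eval x.length) x ≠ some false)}
          ≤ ENNReal.ofReal (1 / (((r.eval x.length : ℕ) : ℝ) + 1))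

/-- Piece 2 (crux): PROMISE-BPP' ORACLE ELIMINATION relative to a random oracle (coins from far positions). -/
def PromiseOracleElimination : Prop :=
  ∀ Q ∈ Literature.Computability.Complexity.PromiseBPP', ∀ (C : OracleAlg Bool) (q : Polynomial ℕ),
    C.IsPolyTime Computability.encodingBoolBool →
    (∀ (O : Oracle) (x : List Bool), ∀ y ∈ C.queries O (q.eval x.length) x, y.length ≤ q.eval x.length) →
    ∀ ℓ r : Polynomial ℕ, ∃ (C' : OracleAlg Bool) (q' : Polynomial ℕ),
      C'.IsPolyTime Computability.encodingBoolBool ∧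
      (∀ (A : Language Bool) (x : List Bool), ∀ y ∈ C'.queries (Oracle.ofLanguage A) (q'.eval x.length) x, y.length ≤ q'.eval x.length) ∧
      ∀ x : List Bool, 1 ≤ x.length →
        ∃ (V : Finset (List Bool)) (ĝ : Set (List Bool) → (List Bool → Bool)),
          (∀ v ∈ V, ℓ.eval x.length < v.length) ∧
          (∀ A : Set (List Bool), ĝ A = ĝ (A ∩ ↑V)) ∧
          (∀ (A : Set (List Bool)) (b : Bool),
            C.run (Oracle.ofLanguage {w : List Bool | ∃ v : List Bool, (w = false :: v ∧ v ∈ A) ∨ (w = true :: v ∧ ĝ A v = true)}) (q.eval x.length) x = some b →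
            C'.run (Oracle.ofLanguage A) (q'.eval x.length) x = some b) ∧
          (ProbabilityTheory.setBernoulli (Set.univ : Set (List Bool)) ⟨1 / 2, by norm_num, by norm_num⟩)
            {A : Set (List Bool) | ¬ ((∀ v ∈ Q.yes, ĝ A v = true) ∧ (∀ v ∈ Q.no, ĝ A v = false))}
            ≤ ENNReal.ofReal (1 / (((r.eval x.length : ℕ) : ℝ) + 1))

/-! ### Vocabulary of the glue (all definitional abbreviations of the inline terms above) -/

/-- The combined oracle `A ⊕ g`: `false :: v ↦ [v ∈ A]`, `true :: v ↦ g v`, `[] ↦ false`. -/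
def combine (A : Set (List Bool)) (g : List Bool → Bool) : Oracle :=
  Oracle.ofLanguage {w : List Bool | ∃ v : List Bool, (w = false :: v ∧ v ∈ A) ∨ (w = true :: v ∧ g v = true)}

/-- `g` answers the promise problem `Q` correctly on its promise. -/
def Consistent (Q : PromiseProblem) (g : List Bool → Bool) : Prop :=
  (∀ v ∈ Q.yes, g v = true) ∧ (∀ v ∈ Q.no, g v = false)

/-- The bad event of piece 1 for a FIXED answer function `g`: `C^{A ⊕ g}` is wrong about the
`BQP`-promise bit of `F^A` at `x`. -/
def badWith (F : QCircuitFamily cliffordT) (C : OracleAlg Bool) (q : Polynomial ℕ) (x : List Bool)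
    (g : List Bool → Bool) : Set (Set (List Bool)) :=
  {A | (2 / 3 ≤ F.acceptProbOn A x ∧ C.run (combine A g) (q.eval x.length) x ≠ some true) ∨
       (F.acceptProbOn A x ≤ 1 / 3 ∧ C.run (combine A g) (q.eval x.length) x ≠ some false)}

/-! ### Locality lemmas -/

/-- Runs are determined by the answers to the queries asked (induction on the fuel; the tree's
`OracleAlg.run_congr`, re-proved here to keep the imports small). -/
theorem runAux_congr {β : Type} (M : OracleAlg β) {O O' : Oracle} (x : List Bool) :
    ∀ (k : ℕ) (ans : List (List Bool)), (∀ y ∈ M.queriesAux O x k ans, O' y = O y) →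
      M.runAux O' x k ans = M.runAux O x k ans ∧ M.queriesAux O' x k ans = M.queriesAux O x k ans
  | 0, _, _ => ⟨rfl, rfl⟩
  | k + 1, ans, h => by
    unfold OracleAlg.runAux OracleAlg.queriesAux
    unfold OracleAlg.queriesAux at h
    cases hs : M.step x ans with
    | inr b => simp
    | inl qy =>
      simp only [hs, List.mem_cons, forall_eq_or_imp] at h
      obtain ⟨hq, hrest⟩ := h
      simp only [hq]
      obtain ⟨h1, h2⟩ := runAux_congr M x k (ans ++ [O qy]) hrest
      exact ⟨h1, by rw [h2]⟩

theorem run_congr {β : Type} (M : OracleAlg β) {O O' : Oracle} {k : ℕ} {x : List Bool}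
    (h : ∀ y ∈ M.queries O k x, O' y = O y) : M.run O' k x = M.run O k x :=
  (runAux_congr M x k [] h).1

/-- Two oracles of languages agree at a string on which membership agrees. -/
theorem ofLanguage_apply_congr {S S' : Set (List Bool)} {y : List Bool} (h : y ∈ S ↔ y ∈ S') :
    Oracle.ofLanguage S y = Oracle.ofLanguage S' y := by
  simp only [Oracle.ofLanguage_apply]
  by_cases hy : y ∈ S
  · rw [(Set.mem_iff_boolIndicator S y).1 hy, (Set.mem_iff_boolIndicator S' y).1 (h.1 hy)]
  · rw [(Set.notMem_iff_boolIndicator S y).1 hy, (Set.notMem_iff_boolIndicator S' y).1 (fun h' => hy (h.2 h'))]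

/-- The combined oracles of two languages agreeing on strings of length `≤ L` agree on queries of
length `≤ L + 1`. -/
theorem combine_congr {A A' : Set (List Bool)} (g : List Bool → Bool) {L : ℕ}
    (h : ∀ v : List Bool, v.length ≤ L → (v ∈ A ↔ v ∈ A')) {y : List Bool} (hy : y.length ≤ L + 1) :
    combine A' g y = combine A g y := by
  refine ofLanguage_apply_congr ?_
  simp only [Set.mem_setOf_eq]
  have key : ∀ v, y = false :: v → (v ∈ A ↔ v ∈ A') := fun v hv => h v (by subst hv; simpa using hy)
  constructor
  · rintro ⟨v, ⟨hv, hvA⟩ | ⟨hv, hvg⟩⟩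
    · exact ⟨v, Or.inl ⟨hv, (key v hv).2 hvA⟩⟩
    · exact ⟨v, Or.inr ⟨hv, hvg⟩⟩
  · rintro ⟨v, ⟨hv, hvA⟩ | ⟨hv, hvg⟩⟩
    · exact ⟨v, Or.inl ⟨hv, (key v hv).1 hvA⟩⟩
    · exact ⟨v, Or.inr ⟨hv, hvg⟩⟩

/-- Equal restrictions to `shortStrings (L + 1)` = agreement on all strings of length `≤ L`. -/
theorem agree_of_restrictBool_eq {L : ℕ} {A A' : Set (List Bool)}
    (h : restrictBool (shortStrings (L + 1)) A = restrictBool (shortStrings (L + 1)) A') :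
    ∀ v : List Bool, v.length ≤ L → (v ∈ A ↔ v ∈ A') := by
  intro v hv
  have hmem : v ∈ shortStrings (L + 1) := mem_shortStrings.2 (by omega)
  have := congrFun h ⟨v, hmem⟩
  rw [restrictBool_apply, restrictBool_apply] at this
  exact (@decide_eq_decide _ _ (Classical.propDecidable _) (Classical.propDecidable _)).1 this

/-- **Locality of the fixed-`g` bad event**: it is determined by the oracle bits on the strings of
length `≤ L` as soon as `L` bounds the width of `F` at `x` and the query length of `C` at `x`. -/
theorem isDetermined_badWith (F : QCircuitFamily cliffordT) (C : OracleAlg Bool) (q : Polynomial ℕ)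
    (x : List Bool) (g : List Bool → Bool) {L : ℕ}
    (hF : x.length + F.ancillas x.length ≤ L + 1)
    (hC : ∀ (O : Oracle), ∀ y ∈ C.queries O (q.eval x.length) x, y.length ≤ q.eval x.length)
    (hq : q.eval x.length ≤ L + 1) :
    IsDetermined (shortStrings (L + 1)) (badWith F C q x g) := by
  intro A A' h
  have hag := agree_of_restrictBool_eq h
  have hp : F.acceptProbOn A x = F.acceptProbOn A' x :=
    QCircuitFamily.acceptProbOn_congr F x fun u hu => hag u (by omega)
  have hr : C.run (combine A g) (q.eval x.length) x = C.run (combine A' g) (q.eval x.length) x := by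
    refine (run_congr C fun y hy => ?_).symm
    exact combine_congr g hag ((hC _ y hy).trans hq)
  simp only [badWith, Set.mem_setOf_eq, hp, hr]

/-! ### The glue -/

/-- **The glue of the split**: `PromiseOracleSimulation → PromiseOracleElimination → PromiseTransfer`. -/
theorem promiseTransfer_of_subs (h₁ : PromiseOracleSimulation) (h₂ : PromiseOracleElimination) :
    Summit.QuantumAdvantage.QuantumAdvantage.Theses.SpikesNeedAddresses.PromiseTransfer := by
  intro hAA hPr
  have key : ∀ᵐ A ∂randomOracleMeasure,
      BQPRel (A : Language Bool) ⊆
        Literature.Barriers.QuantumAdvantage.AvgPRel (Oracle.ofLanguage (A : Language Bool)) := by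
    refine ae_BQPRel_subset_AvgPRel_of_apxMachines fun F hU => ?_
    -- polynomial size of the uniform family (width bound)
    obtain ⟨pF, hpF⟩ := QCircuitFamily.IsUniform.isPolySize' hU
    -- piece 1 with error polynomial `4 X³`
    obtain ⟨Q, hQ, C, q, hCpoly, hCq, hC⟩ := h₁ hAA F hU (4 * Polynomial.X ^ 3)
    -- the hypothesis of `PromiseTransfer` moves `Q` into `PromiseBPP'`
    have hQ' : Q ∈ PromiseBPP' := hPr hQ
    -- piece 2 with the short horizon `ℓ = X + pF + q` and error polynomial `2 X³`
    obtain ⟨C', q', hC'poly, hC'q, hC'⟩ :=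
      h₂ Q hQ' C q hCpoly hCq (Polynomial.X + pF + q) (2 * Polynomial.X ^ 3)
    refine ⟨C', q', hC'poly, hC'q, fun x hx => ?_⟩
    obtain ⟨V, ĝ, hVfar, hĝloc, hrun, hincons⟩ := hC' x hx
    -- notation: the short horizon `L = ℓ(n) = n + pF(n) + q(n)` and the short window `S`
    set L : ℕ := (Polynomial.X + pF + q).eval x.length with hL
    have hLeval : L = x.length + pF.eval x.length + q.eval x.length := by
      simp [hL, Polynomial.eval_add, Polynomial.eval_X]
    set S : Finset (List Bool) := shortStrings (L + 1) with hS
    have hwidth : x.length + F.ancillas x.length ≤ L + 1 := by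
      have := (hpF x.length).2; rw [hLeval]; omega
    have hqL : q.eval x.length ≤ L + 1 := by rw [hLeval]; omega
    have hdet : ∀ g, IsDetermined S (badWith F C q x g) := fun g =>
      isDetermined_badWith F C q x g hwidth (fun O => hCq O x) hqL
    -- `V` misses the short window
    have hVS : ∀ v ∈ V, v ∉ S := fun v hv hvS => by
      have h1 := hVfar v hv; have h2 := mem_shortStrings.1 hvS; omega
    -- the two covering events
    set B₁ : Set (Set (List Bool)) := {A | ¬ Consistent Q (ĝ A)} with hB₁
    set B₂ : Set (Set (List Bool)) := {A | Consistent Q (ĝ A) ∧ A ∈ badWith F C q x (ĝ A)} with hB₂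
    have hsub : badEvent F C' q' x ⊆ B₁ ∪ B₂ := by
      intro A hA
      by_cases hc : Consistent Q (ĝ A)
      · refine Or.inr ⟨hc, ?_⟩
        rcases hA with ⟨hp, hne⟩ | ⟨hp, hne⟩
        · exact Or.inl ⟨hp, fun heq => hne (hrun A true heq)⟩
        · exact Or.inr ⟨hp, fun heq => hne (hrun A false heq)⟩
      · exact Or.inl hc
    -- bound on `B₁`: piece 2
    have hB₁le : randomOracleMeasure B₁ ≤
        ENNReal.ofReal (1 / ((((2 * Polynomial.X ^ 3 : Polynomial ℕ).eval x.length : ℕ) : ℝ) + 1)) :=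
      hincons
    -- `ĝ` ignores the short window
    have hĝpatch : ∀ (A₀ : Set (List Bool)) (w : S → Bool), ĝ (patchFin A₀ S w) = ĝ A₀ := by
      intro A₀ w
      rw [hĝloc (patchFin A₀ S w), hĝloc A₀]
      congr 1
      ext s
      simp only [Set.mem_inter_iff, Finset.mem_coe]
      constructor
      · rintro ⟨hs, hsV⟩; exact ⟨(mem_patchFin_of_not_mem w (hVS s hsV)).1 hs, hsV⟩
      · rintro ⟨hs, hsV⟩; exact ⟨(mem_patchFin_of_not_mem w (hVS s hsV)).2 hs, hsV⟩
    -- `B₂` is determined by the finite set `S ∪ V`, hence measurable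
    have hB₂det : IsDetermined (S ∪ V) B₂ := by
      intro A A' h
      have hSA : restrictBool S A = restrictBool S A' := funext fun u => by
        have := congrFun h ⟨u.1, Finset.mem_union_left V u.2⟩
        simpa only [restrictBool_apply] using this
      have hVA : A ∩ ↑V = A' ∩ ↑V := by
        ext s
        simp only [Set.mem_inter_iff, Finset.mem_coe]
        constructor
        · rintro ⟨hs, hsV⟩
          have := congrFun h ⟨s, Finset.mem_union_right S hsV⟩
          rw [restrictBool_apply, restrictBool_apply] at this
          exact ⟨((@decide_eq_decide _ _ (Classical.propDecidable _) (Classical.propDecidable _)).1 this).1 hs, hsV⟩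
        · rintro ⟨hs, hsV⟩
          have := congrFun h ⟨s, Finset.mem_union_right S hsV⟩
          rw [restrictBool_apply, restrictBool_apply] at this
          exact ⟨((@decide_eq_decide _ _ (Classical.propDecidable _) (Classical.propDecidable _)).1 this).2 hs, hsV⟩
      have hĝA : ĝ A = ĝ A' := by rw [hĝloc A, hĝloc A', hVA]
      simp only [hB₂, Set.mem_setOf_eq, hĝA, hdet (ĝ A') hSA]
    have hB₂meas : MeasurableSet B₂ := hB₂det.measurableSet
    -- bound on `B₂`: the window lemma with the short window `S`, trivial background event
    set θ : ℝ≥0∞ :=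
      ENNReal.ofReal (1 / ((((4 * Polynomial.X ^ 3 : Polynomial ℕ).eval x.length : ℕ) : ℝ) + 1)) with hθ
    have hB₂le : randomOracleMeasure B₂ ≤ θ := by
      have hwin := measure_inter_le_of_window S (E := B₂) (F := Set.univ) (θ := θ) hB₂meas
        MeasurableSet.univ (fun A => by simp) (fun A₀ => ?_)
      · simpa using hwin
      -- per background: the piece-1 bound for the FIXED consistent `g = ĝ A₀` (or the empty set)
      rw [← randomOracleMeasure_patchFin_mem B₂ S A₀]
      by_cases hc : Consistent Q (ĝ A₀)
      · have hset : {A : Set (List Bool) | patchFin A₀ S (restrictBool S A) ∈ B₂} = badWith F C q x (ĝ A₀) := by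
          ext A
          simp only [hB₂, Set.mem_setOf_eq, hĝpatch]
          rw [hdet (ĝ A₀) (restrictBool_patchFin A₀ S (restrictBool S A))]
          exact ⟨fun h => h.2, fun h => ⟨hc, h⟩⟩
        rw [hset]
        exact hC x hx (ĝ A₀) hc.1 hc.2
      · have hset : {A : Set (List Bool) | patchFin A₀ S (restrictBool S A) ∈ B₂} = ∅ := by
          ext A
          simp only [hB₂, Set.mem_setOf_eq, hĝpatch, Set.mem_empty_iff_false, iff_false, not_and]
          exact fun h => absurd h hc
        rw [hset, measure_empty]
        exact bot_le
    -- arithmetic: `1/(2n³+1) + 1/(4n³+1) < 1/n³`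
    set n : ℕ := x.length with hn
    have h2 : ((2 * Polynomial.X ^ 3 : Polynomial ℕ).eval n : ℕ) = 2 * n ^ 3 := by
      simp [Polynomial.eval_mul, Polynomial.eval_pow, Polynomial.eval_X]
    have h4 : ((4 * Polynomial.X ^ 3 : Polynomial ℕ).eval n : ℕ) = 4 * n ^ 3 := by
      simp [Polynomial.eval_mul, Polynomial.eval_pow, Polynomial.eval_X]
    have hn1 : (1 : ℝ) ≤ n := by exact_mod_cast hx
    have hN : (1 : ℝ) ≤ (n : ℝ) ^ 3 := one_le_pow₀ hn1
    have hreal : 1 / ((((2 * n ^ 3 : ℕ)) : ℝ) + 1) + 1 / ((((4 * n ^ 3 : ℕ)) : ℝ) + 1) < 1 / (n : ℝ) ^ 3 := by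
      push_cast
      rw [div_add_div _ _ (by positivity) (by positivity), div_lt_div_iff₀ (by positivity) (by positivity)]
      nlinarith [hN]
    calc randomOracleMeasure (badEvent F C' q' x)
        ≤ randomOracleMeasure (B₁ ∪ B₂) := measure_mono hsub
      _ ≤ randomOracleMeasure B₁ + randomOracleMeasure B₂ := measure_union_le _ _
      _ ≤ ENNReal.ofReal (1 / ((((2 * n ^ 3 : ℕ)) : ℝ) + 1)) + ENNReal.ofReal (1 / ((((4 * n ^ 3 : ℕ)) : ℝ) + 1)) := by
          refine add_le_add ?_ ?_
          · rw [← h2]; exact hB₁le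
          · rw [← h4]; exact hB₂le
      _ = ENNReal.ofReal (1 / ((((2 * n ^ 3 : ℕ)) : ℝ) + 1) + 1 / ((((4 * n ^ 3 : ℕ)) : ℝ) + 1)) :=
          (ENNReal.ofReal_add (by positivity) (by positivity)).symm
      _ < ENNReal.ofReal (1 / (n : ℝ) ^ 3) := by
          rw [ENNReal.ofReal_lt_ofReal_iff (by positivity)]
          exact hreal
  exact key

/-- The same glue closes the SHARED item's other spelling (route RandomOracleGauge, stmt-10749:
`randomOracleMeasure`, `AvgPRel`, `evalBool`/`boolVariance`/`influence` by name) — definitionally equal. -/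
theorem promiseTransfer_of_subs_gauge (h₁ : PromiseOracleSimulation) (h₂ : PromiseOracleElimination) :
    Summit.QuantumAdvantage.QuantumAdvantage.Theses.RandomOracleGauge.PromiseTransfer :=
  promiseTransfer_of_subs h₁ h₂

end Summit.QuantumAdvantage.QuantumAdvantage.Cruxes.PromiseTransfer.PromiseOracleSplit

end
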